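import Literature.NumberTheory.Sieve.MaynardSieveLemma51
import Literature.NumberTheory.Sieve.MaynardSieveLemma53
import Literature.NumberTheory.Sieve.MaynardEquidistribution
import HarnessLib

/-!
# Maynard 2015, Lemma 6.2 proved: the named facts `Literature.NumberTheory.Sieve.maynard_lemma62_sum` and `Literature.NumberTheory.Sieve.maynard_S1_asymptotic`

Topic `Literature/NumberTheory/Sieve`; sequel of `MaynardSieveLemma51.lean` (Lemma 5.1,
`Literature.NumberTheory.Sieve.maynard_lemma51_holds`, and `maynard_S1_asymptotic_of_lemma62_sum`). J. Maynard, *Small gaps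
between primes*, Ann. of Math. (2) 181 (2015), 383–413 = arXiv:1311.4600v3, **Lemma 6.2** (the `S₁`
half of Proposition 4.1): with the choice (6.3) `y_r = F(log r₁/log R, …, log r_k/log R)` (on good
tuples `r`: `∏ rᵢ` squarefree and coprime to `W`),
`S₁ = (1 + o(1)) φ(W)^k N (log R)^k/W^{k+1} · I_k(F)`.

Everything in this file is PROVED (theorems only). The tree vendors the two steps of the printed
proof as named facts: Lemma 5.1 (`Literature.NumberTheory.Sieve.maynard_lemma51`, proved in `MaynardSieveLemma51.lean`) and the
evaluation (6.4)–(6.7) of the diagonal sum,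
`∑_r y_r²/∏ φ(rᵢ) = (φ(W)/W)^k (log R)^k (I_k(F) + o(1))` (`Literature.NumberTheory.Sieve.maynard_lemma62_sum`,
`MaynardSieveS1.lean`). Here we prove the latter and conclude:

* `maynardY_sq_eq`, `sum_maynardY_sq_div_eq` — (6.4): on the box, `y_r² = 1[r good] F(x_r)²`,
  `x_r = (log rᵢ/log R)ᵢ` (`maynardY_eq` of `MaynardSieveWeights.lean`);
* `weightedSum_wfun_eq`, `weightedSum_wfun_sub_eq`, `abs_sum_bad_le` — (6.5): relaxing "good" to
  "each `rᵢ` squarefree and coprime to `W`" turns the sum into the product-weight sum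
  `MaynardTao.weightedSum` of `MaynardEquidistribution.lean` for the weight `μ²(n) 1_{(n,W)=1}/φ(n)`
  (written `wfun W cTot n / n` with the squarefree weights of `CoprimeSquarefreeSums`); the added
  tuples have two coordinates divisible by a common prime `p > D₀` and cost at most
  `F_max² k² L^k/(D₀ − 1)`, `L = ∑_{u ≤ R, (u,W)=1} μ²(u)/φ(u)`
  (`sum_prod_inv_totient_not_isGood_le`: union bound over `(i, j, p)`, the factorisation
  `∑_{p ∣ uᵢ, p ∣ uⱼ} ∏ 1/φ(u_l) = L_p² L^{k−2}` with `L_p ≤ L/(p − 1)`, and `∑_{p > D₀} 1/(p−1)² ≤ 1/(D₀−1)`);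
* (6.6)–(6.7): instead of `k` applications of the partial-summation Lemma 6.1, the tree's
  `k`-dimensional Riemann-sum estimate `MaynardTao.abs_weightedSum_sub_integral_le`, fed with the
  counting function `L(y) = (φ(W)/W) log y (1 + O(D₀^{-1/4})) + O(harmErr W)`
  (`abs_massUpTo_wfun_sub_le`, from `SquarefreeSums.abs_sum_inv_totient_sub_le`) and the uniform
  continuity of `G²` on `[0,1]^k`; `∫_{[0,1]^k} 1_{R_k} G² = I_k(F)` (`integral_cube_indicator_sq_eq`);
* `maynard_lemma62_sum_holds : maynard_lemma62_sum` — the assembly in `o`-form: given `ε₀`, choose the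
  mesh `M` from the modulus of continuity of `G²`, then `N` large (`D₀ = ⌊log log log N⌋ → ∞`,
  `8^{D₀} ≤ (log log N)³`, `φ(W)/W ≥ 1/D₀`, `L ≤ (2 + B(2)) (φ(W)/W) log R` — the bookkeeping lemmas of
  `MaynardSieveLemma51.lean`);
* `maynard_S1_asymptotic_holds : maynard_S1_asymptotic` — **Lemma 6.2**, the named fact of
  `MaynardSieve.lean` DISCHARGED (`maynard_S1_asymptotic_of_lemma62_sum`).

After this file the Maynard–Tao route to `Literature.NumberTheory.Sieve.frequently_card_primes_ge_of_maynardFunctional_smooth`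
through `MaynardSieve.lean` rests on the `S₂` half alone (`maynard_S2_asymptotic`, reduced in
`MaynardSieveS2.lean` to Lemma 5.2 and the two evaluations of the proof of Lemma 6.3).

## References

* J. Maynard, *Small gaps between primes*, Ann. of Math. (2) 181 (2015), 383–413,
  doi:10.4007/annals.2015.181.1.7 = arXiv:1311.4600v3: Lemma 6.2 and its proof, displays
  (6.3)–(6.7), pp. 13–14; Lemma 6.1 (quoted from Goldston–Graham–Pintz–Yıldırım, Proc. LMS 98 (2009),
  Lemma 4). [cite: MaynardAnnals2015]
-/

open Finset Filter Asymptotics MeasureTheory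

open scoped ArithmeticFunction.Moebius

namespace Literature.NumberTheory.Sieve
namespace MaynardSieve

/-! ### The one-dimensional weight `μ²(n) 1_{(n,W)=1}/φ(n)` and its counting function -/

/-- The weight of one coordinate of the diagonal sum `∑_r y_r²/∏ φ(rᵢ)` (Maynard 2015, (6.5)) is
`w(n)/n` for the squarefree weight `w = wfun W cTot` of `CoprimeSquarefreeSums` (`c_p = 1/(p−1)`):
`w(n)/n = μ²(n) 1_{(n,W)=1}/φ(n)` for `n ≥ 1`. [cite: MaynardAnnals2015, proof of Lemma 6.2, (6.5)] -/
theorem wfun_cTot_div_eq_ite {W n : ℕ} (hn : n ≠ 0) :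
    SquarefreeSums.wfun W SquarefreeSums.cTot n / n =
      if Squarefree n ∧ n.Coprime W then 1 / (n.totient : ℝ) else 0 := by
  split_ifs with h
  · exact SquarefreeSums.wfun_cTot_div hn h.1 h.2
  · rcases not_and_or.1 h with h | h
    · rw [SquarefreeSums.wfun_eq_zero_of_not_squarefree h, zero_div]
    · rw [SquarefreeSums.wfun_eq_zero_of_not_coprime h, zero_div]

/-- The weight `w(n)/n` is nonnegative. [folklore] -/
theorem wfun_cTot_div_nonneg (W n : ℕ) : 0 ≤ SquarefreeSums.wfun W SquarefreeSums.cTot n / n := by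
  rcases eq_or_ne n 0 with rfl | hn
  · simp
  · rw [wfun_cTot_div_eq_ite hn]
    split_ifs <;> positivity

/-- Its counting function is `L(B) = ∑_{n ≤ B, (n,W)=1} μ²(n)/φ(n)`. [folklore] -/
theorem massUpTo_wfun_cTot_div (W B : ℕ) :
    MaynardTao.massUpTo (fun n => SquarefreeSums.wfun W SquarefreeSums.cTot n / n) B =
      ∑ n ∈ G1 W B, 1 / (n.totient : ℝ) := by
  rw [MaynardTao.massUpTo, G1, Finset.sum_filter]
  refine Finset.sum_congr rfl fun n hn => ?_
  have hn0 : n ≠ 0 := by have := (Finset.mem_Icc.1 hn).1; omega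
  exact wfun_cTot_div_eq_ite hn0

/-- **The counting-function hypothesis of the equidistribution lemma** for `μ²(n) 1_{(n,W)=1}/φ(n)`:
`|L(⌊y⌋) − (φ(W)/W) log y| ≤ ε (φ(W)/W) log y + E` for `y ≥ 1`, with `ε = B(2) D₀^{-1/4}` and
`E = (harmErr W + 4) B(2) + 1`, when every prime `≤ D₀` divides `W` (from
`SquarefreeSums.abs_sum_inv_totient_sub_le` and `log y − log ⌊y⌋ ≤ 1`).
[cite: MaynardAnnals2015, (6.5)] -/
theorem abs_massUpTo_wfun_sub_le {W : ℕ} (hW : W ≠ 0) {D₀ : ℕ} (hD0 : 1 ≤ D₀)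
    (hD : ∀ p, p.Prime → p ≤ D₀ → p ∣ W) {y : ℝ} (hy : 1 ≤ y) :
    |MaynardTao.massUpTo (fun n => SquarefreeSums.wfun W SquarefreeSums.cTot n / n) ⌊y⌋₊ -
        (W.totient : ℝ) / W * Real.log y| ≤
      SquarefreeSums.bConst 2 * (D₀ : ℝ) ^ (-(1 : ℝ) / 4) * ((W.totient : ℝ) / W) * Real.log y +
        ((SquarefreeSums.harmErr W + 4) * SquarefreeSums.bConst 2 + 1) := by
  have hB : 1 ≤ ⌊y⌋₊ := Nat.le_floor (by simpa using hy)
  have h := SquarefreeSums.abs_sum_inv_totient_sub_le hW hD0 hD hB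
  rw [← G1, ← massUpTo_wfun_cTot_div] at h
  set c : ℝ := (W.totient : ℝ) / W with hc
  set b : ℝ := SquarefreeSums.bConst 2 with hb
  set K : ℝ := (SquarefreeSums.harmErr W + 4) * b with hK
  have hy0 : 0 < y := by linarith
  have hBpos : (0 : ℝ) < ⌊y⌋₊ := by exact_mod_cast hB
  have hBy : (⌊y⌋₊ : ℝ) ≤ y := Nat.floor_le hy0.le
  have hyB : y ≤ 2 * ⌊y⌋₊ := by
    have h1 : y < ⌊y⌋₊ + 1 := Nat.lt_floor_add_one y
    have h2 : (1 : ℝ) ≤ ⌊y⌋₊ := by exact_mod_cast hB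
    linarith
  have hlogB : Real.log ⌊y⌋₊ ≤ Real.log y := Real.log_le_log hBpos hBy
  have hlogB0 : 0 ≤ Real.log ⌊y⌋₊ := Real.log_nonneg (by exact_mod_cast hB)
  have hlogy0 : 0 ≤ Real.log y := Real.log_nonneg hy
  have hlog2 : Real.log y - Real.log ⌊y⌋₊ ≤ 1 := by
    rw [← Real.log_div hy0.ne' hBpos.ne']
    calc Real.log (y / ⌊y⌋₊) ≤ Real.log 2 :=
          Real.log_le_log (by positivity) (by rw [div_le_iff₀ hBpos]; linarith)
      _ ≤ 1 := by have := Real.log_two_lt_d9; linarith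
  have hc0 : 0 ≤ c := by rw [hc]; positivity
  have hc1 : c ≤ 1 := by
    rw [hc, div_le_one (by exact_mod_cast Nat.pos_of_ne_zero hW)]
    exact_mod_cast Nat.totient_le W
  have hb0 : 0 ≤ b := by rw [hb]; unfold SquarefreeSums.bConst; positivity
  have hD14 : 0 ≤ (D₀ : ℝ) ^ (-(1 : ℝ) / 4) := by positivity
  have h' := abs_sub_le_iff.1 h
  rw [abs_sub_le_iff]
  constructor
  · calc MaynardTao.massUpTo (fun n => SquarefreeSums.wfun W SquarefreeSums.cTot n / n) ⌊y⌋₊ - c * Real.log y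
        ≤ MaynardTao.massUpTo (fun n => SquarefreeSums.wfun W SquarefreeSums.cTot n / n) ⌊y⌋₊ - c * Real.log ⌊y⌋₊ := by gcongr
      _ ≤ K + c * (b * (D₀ : ℝ) ^ (-(1 : ℝ) / 4)) * Real.log ⌊y⌋₊ := h'.1
      _ ≤ K + c * (b * (D₀ : ℝ) ^ (-(1 : ℝ) / 4)) * Real.log y := by gcongr
      _ ≤ b * (D₀ : ℝ) ^ (-(1 : ℝ) / 4) * c * Real.log y + (K + 1) := by nlinarith
  · calc c * Real.log y - MaynardTao.massUpTo (fun n => SquarefreeSums.wfun W SquarefreeSums.cTot n / n) ⌊y⌋₊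
        = c * (Real.log y - Real.log ⌊y⌋₊) + (c * Real.log ⌊y⌋₊ - MaynardTao.massUpTo (fun n => SquarefreeSums.wfun W SquarefreeSums.cTot n / n) ⌊y⌋₊) := by
          ring
      _ ≤ 1 + (K + c * (b * (D₀ : ℝ) ^ (-(1 : ℝ) / 4)) * Real.log ⌊y⌋₊) := by
          have h1 : c * (Real.log y - Real.log ⌊y⌋₊) ≤ 1 := by nlinarith
          linarith [h'.2]
      _ ≤ 1 + (K + c * (b * (D₀ : ℝ) ^ (-(1 : ℝ) / 4)) * Real.log y) := by gcongr
      _ = b * (D₀ : ℝ) ^ (-(1 : ℝ) / 4) * c * Real.log y + (K + 1) := by ring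

/-- `∑_{n ∈ G1, p ∣ n} 1/φ(n) ≤ L/(p − 1)` for a prime `p`: `n ↦ n/p` is injective into `G1` and
`φ(n) = (p − 1) φ(n/p)` (`n` squarefree). [cite: MaynardAnnals2015, proof of Lemma 6.2, (6.5)] -/
theorem sum_G1_filter_dvd_le {W B p : ℕ} (hp : p.Prime) :
    ∑ n ∈ (G1 W B).filter (fun n => p ∣ n), 1 / (n.totient : ℝ) ≤
      1 / ((p : ℝ) - 1) * ∑ n ∈ G1 W B, 1 / (n.totient : ℝ) := by
  have hp1 : (1 : ℝ) < p := by exact_mod_cast hp.one_lt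
  have hp1' : 0 < (p : ℝ) - 1 := by linarith
  -- `φ(n) = (p-1) φ(n/p)` on the filtered set
  have hphi : ∀ n ∈ (G1 W B).filter (fun n => p ∣ n),
      1 / (n.totient : ℝ) = 1 / ((p : ℝ) - 1) * (1 / ((n / p).totient : ℝ)) := by
    intro n hn
    rw [Finset.mem_filter, mem_G1] at hn
    obtain ⟨⟨⟨hn1, -⟩, hsq, -⟩, hpn⟩ := hn
    obtain ⟨m, rfl⟩ := hpn
    have hpm : Nat.Coprime p m := by
      rw [Nat.Prime.coprime_iff_not_dvd hp]
      intro hpm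
      obtain ⟨t, rfl⟩ := hpm
      have : p * p ∣ p * (p * t) := ⟨t, by ring⟩
      exact hp.ne_one (Nat.isUnit_iff.1 (hsq p this))
    rw [Nat.mul_div_cancel_left m hp.pos, Nat.totient_mul hpm, Nat.totient_prime hp]
    have : ((p - 1 : ℕ) : ℝ) = (p : ℝ) - 1 := by
      rw [Nat.cast_sub hp.one_le]; simp
    push_cast [this]
    rw [one_div_mul_one_div]
  rw [Finset.sum_congr rfl hphi, ← Finset.mul_sum]
  refine mul_le_mul_of_nonneg_left ?_ (by positivity)
  -- reindex by `m = n / p`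
  have hinj : Set.InjOn (fun n => n / p) ((G1 W B).filter (fun n => p ∣ n) : Set ℕ) := by
    intro n hn n' hn' h
    rw [Finset.coe_filter] at hn hn'
    have h1 := Nat.div_mul_cancel hn.2
    have h2 := Nat.div_mul_cancel hn'.2
    have h3 : n / p * p = n' / p * p := by rw [show n / p = n' / p from h]
    rw [h1, h2] at h3
    exact h3
  rw [← Finset.sum_image (f := fun m => 1 / (m.totient : ℝ)) hinj]
  refine Finset.sum_le_sum_of_subset_of_nonneg (fun m hm => ?_) fun _ _ _ => by positivity
  rw [Finset.mem_image] at hm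
  obtain ⟨n, hn, rfl⟩ := hm
  rw [Finset.mem_filter] at hn
  exact mem_G1_of_dvd hn.1 (Nat.div_dvd_of_dvd hn.2)

/-! ### Squarefree products and the bad tuples -/

/-- A product of pairwise coprime squarefree numbers is squarefree. [folklore] -/
theorem squarefree_prod_of_pairwise {ι : Type*} (s : Finset ι) (r : ι → ℕ)
    (hsq : ∀ i ∈ s, Squarefree (r i))
    (hco : ∀ i ∈ s, ∀ j ∈ s, i ≠ j → Nat.Coprime (r i) (r j)) :
    Squarefree (∏ i ∈ s, r i) := by
  classical
  induction s using Finset.induction_on with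
  | empty => simp
  | insert a s ha ih =>
    rw [Finset.prod_insert ha]
    have hcop : Nat.Coprime (r a) (∏ i ∈ s, r i) :=
      Nat.Coprime.prod_right fun i hi => hco a (Finset.mem_insert_self a s) i
        (Finset.mem_insert_of_mem hi) (fun h => ha (h ▸ hi))
    rw [Nat.squarefree_mul hcop]
    exact ⟨hsq a (Finset.mem_insert_self a s),
      ih (fun i hi => hsq i (Finset.mem_insert_of_mem hi))
        (fun i hi j hj hij => hco i (Finset.mem_insert_of_mem hi) j (Finset.mem_insert_of_mem hj) hij)⟩

variable {k : ℕ}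

/-- A coordinatewise good tuple (each `rᵢ` squarefree and coprime to `W`) which is not good has two
coordinates with a common prime factor `p`, and `D₀ < p ≤ B` when every prime `≤ D₀` divides `W`.
[cite: MaynardAnnals2015, proof of Lemma 6.2, before (6.5)] -/
theorem exists_prime_dvd_two_of_not_isGood {W B D₀ : ℕ} (hD : ∀ p, p.Prime → p ≤ D₀ → p ∣ W)
    {r : Fin k → ℕ} (hr : ∀ i, r i ∈ G1 W B) (hng : ¬IsGood W r) :
    ∃ ij ∈ (Finset.univ : Finset (Fin k)).offDiag, ∃ p ∈ (Finset.Ioc D₀ B).filter Nat.Prime,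
      p ∣ r ij.1 ∧ p ∣ r ij.2 := by
  classical
  have hr' := fun i => mem_G1.1 (hr i)
  have hcopW : (∏ i, r i).Coprime W := Nat.Coprime.prod_left fun i _ => (hr' i).2.2
  have hnsq : ¬Squarefree (∏ i, r i) := fun h => hng ⟨h, hcopW⟩
  -- two coordinates are not coprime
  have hex : ∃ i j, i ≠ j ∧ ¬Nat.Coprime (r i) (r j) := by
    by_contra hcon
    push Not at hcon
    exact hnsq (squarefree_prod_of_pairwise Finset.univ r (fun i _ => (hr' i).2.1)
      fun i _ j _ hij => hcon i j hij)
  obtain ⟨i, j, hij, hnc⟩ := hex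
  obtain ⟨p, hp, hpg⟩ := Nat.exists_prime_and_dvd (n := Nat.gcd (r i) (r j)) hnc
  have hpi : p ∣ r i := hpg.trans (Nat.gcd_dvd_left _ _)
  have hpj : p ∣ r j := hpg.trans (Nat.gcd_dvd_right _ _)
  refine ⟨(i, j), Finset.mem_offDiag.2 ⟨Finset.mem_univ _, Finset.mem_univ _, hij⟩, p,
    Finset.mem_filter.2 ⟨Finset.mem_Ioc.2 ⟨?_, ?_⟩, hp⟩, hpi, hpj⟩
  · by_contra hle
    push Not at hle
    have hpW : p ∣ W := hD p hp hle
    have hcop : Nat.Coprime (r i) W := (hr' i).2.2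
    have : p ∣ Nat.gcd (r i) W := Nat.dvd_gcd hpi hpW
    rw [hcop] at this
    exact hp.ne_one (Nat.dvd_one.1 this)
  · exact (Nat.le_of_dvd (hr' i).1.1 hpi).trans (hr' i).1.2

/-- The product weight `∏ᵢ 1/φ(tᵢ)` summed over the coordinatewise good tuples with `p ∣ tᵢ`,
`p ∣ tⱼ` (`i ≠ j`) is at most `L^k/(p−1)²`, `L = ∑_{n ∈ G1} 1/φ(n)`. [cite: MaynardAnnals2015, (6.5)] -/
theorem sum_prod_inv_totient_filter_dvd_le {W B p : ℕ} (hp : p.Prime) (hB : 1 ≤ B)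
    {i j : Fin k} (hij : i ≠ j) :
    ∑ t ∈ (Fintype.piFinset fun _ : Fin k => G1 W B).filter (fun t => p ∣ t i ∧ p ∣ t j),
        ∏ l, 1 / ((t l).totient : ℝ) ≤
      (∑ n ∈ G1 W B, 1 / (n.totient : ℝ)) ^ k / ((p : ℝ) - 1) ^ 2 := by
  classical
  set L := ∑ n ∈ G1 W B, 1 / (n.totient : ℝ) with hL
  set Lp := ∑ n ∈ (G1 W B).filter (fun n => p ∣ n), 1 / (n.totient : ℝ) with hLp
  have hp1 : (1 : ℝ) < p := by exact_mod_cast hp.one_lt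
  have hL0 : 0 ≤ L := Finset.sum_nonneg fun _ _ => by positivity
  have hLp0 : 0 ≤ Lp := Finset.sum_nonneg fun _ _ => by positivity
  have h1G : 1 ∈ G1 W B := mem_G1.2 ⟨⟨le_rfl, hB⟩, squarefree_one, Nat.coprime_one_left W⟩
  have hL1 : 1 ≤ L := by
    have := Finset.single_le_sum (f := fun n : ℕ => 1 / (n.totient : ℝ)) (fun _ _ => by positivity) h1G
    rw [Nat.totient_one, Nat.cast_one, div_one] at this
    exact this
  have hLpL : Lp ≤ 1 / ((p : ℝ) - 1) * L := sum_G1_filter_dvd_le hp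
  -- the filtered box is a product box
  set T : Fin k → Finset ℕ := fun l => if l = i ∨ l = j then (G1 W B).filter (fun n => p ∣ n) else G1 W B
    with hT
  have hset : (Fintype.piFinset fun _ : Fin k => G1 W B).filter (fun t => p ∣ t i ∧ p ∣ t j) =
      Fintype.piFinset T := by
    ext t
    simp only [Finset.mem_filter, Fintype.mem_piFinset, hT]
    constructor
    · rintro ⟨h, hi, hj⟩ l
      by_cases hl : l = i ∨ l = j
      · rw [if_pos hl, Finset.mem_filter]
        rcases hl with rfl | rfl
        · exact ⟨h l, hi⟩
        · exact ⟨h l, hj⟩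
      · rw [if_neg hl]; exact h l
    · intro h
      have hmem : ∀ l, t l ∈ G1 W B := fun l => by
        have := h l
        by_cases hl : l = i ∨ l = j
        · rw [if_pos hl, Finset.mem_filter] at this; exact this.1
        · rwa [if_neg hl] at this
      have hi := h i
      have hj := h j
      rw [if_pos (Or.inl rfl), Finset.mem_filter] at hi
      rw [if_pos (Or.inr rfl), Finset.mem_filter] at hj
      exact ⟨hmem, hi.2, hj.2⟩
  rw [hset, ← Finset.prod_univ_sum T (fun _ n => 1 / (n.totient : ℝ))]
  have hfac : ∀ l, ∑ n ∈ T l, 1 / (n.totient : ℝ) = if l = i ∨ l = j then Lp else L := by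
    intro l
    by_cases hl : l = i ∨ l = j
    · simp only [hT, if_pos hl, hLp]
    · simp only [hT, if_neg hl, hL]
  simp_rw [hfac]
  rw [← Finset.mul_prod_erase _ _ (Finset.mem_univ i), if_pos (Or.inl rfl),
    ← Finset.mul_prod_erase _ _ (Finset.mem_erase.2 ⟨hij.symm, Finset.mem_univ j⟩),
    if_pos (Or.inr rfl)]
  have hrest : ∏ x ∈ (Finset.univ.erase i).erase j, (if x = i ∨ x = j then Lp else L) = L ^ (k - 2) := by
    calc _ = ∏ x ∈ (Finset.univ.erase i).erase j, L := by
          refine Finset.prod_congr rfl fun x hx => ?_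
          rw [Finset.mem_erase, Finset.mem_erase] at hx
          rw [if_neg (not_or.2 ⟨hx.2.1, hx.1⟩)]
      _ = L ^ (k - 2) := by
          rw [Finset.prod_const]
          congr 1
          rw [Finset.card_erase_of_mem (Finset.mem_erase.2 ⟨hij.symm, Finset.mem_univ j⟩),
            Finset.card_erase_of_mem (Finset.mem_univ i), Finset.card_univ, Fintype.card_fin]
          omega
  rw [hrest]
  have hk2 : 2 ≤ k := by
    have : Fintype.card (Fin k) = k := Fintype.card_fin k
    have h2 : ({i, j} : Finset (Fin k)).card ≤ Fintype.card (Fin k) := Finset.card_le_univ _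
    rw [Finset.card_pair hij] at h2
    omega
  calc Lp * (Lp * L ^ (k - 2)) ≤ (1 / ((p : ℝ) - 1) * L) * ((1 / ((p : ℝ) - 1) * L) * L ^ (k - 2)) := by
        gcongr
    _ = L ^ (k - 2 + 2) / ((p : ℝ) - 1) ^ 2 := by rw [pow_add]; field_simp
    _ = L ^ k / ((p : ℝ) - 1) ^ 2 := by rw [Nat.sub_add_cancel hk2]

/-- **The bad tuples** (Maynard 2015, (6.5)): the total product weight `∏ 1/φ(tᵢ)` of the
coordinatewise good tuples of `[1, B]^k` that are not good (two coordinates share a prime, which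
then exceeds `D₀`) is at most `k² L^k/(D₀ − 1)`. [cite: MaynardAnnals2015, proof of Lemma 6.2, (6.5)] -/
theorem sum_prod_inv_totient_not_isGood_le {W B D₀ : ℕ} (hB : 1 ≤ B) (hD2 : 2 ≤ D₀)
    (hD : ∀ p, p.Prime → p ≤ D₀ → p ∣ W) :
    ∑ t ∈ (Fintype.piFinset fun _ : Fin k => G1 W B).filter (fun t => ¬IsGood W t),
        ∏ l, 1 / ((t l).totient : ℝ) ≤
      (k : ℝ) ^ 2 * (∑ n ∈ G1 W B, 1 / (n.totient : ℝ)) ^ k / ((D₀ : ℝ) - 1) := by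
  classical
  have hL0 : 0 ≤ ∑ n ∈ G1 W B, 1 / (n.totient : ℝ) := Finset.sum_nonneg fun _ _ => by positivity
  have hw0 : ∀ t ∈ (Fintype.piFinset fun _ : Fin k => G1 W B), 0 ≤ ∏ l, 1 / ((t l).totient : ℝ) :=
    fun t _ => Finset.prod_nonneg fun _ _ => by positivity
  -- the "reasons" `q = ((i, j), p)`
  obtain ⟨Q, hQ⟩ : ∃ Q : Finset ((Fin k × Fin k) × ℕ),
      Q = (Finset.univ : Finset (Fin k)).offDiag ×ˢ (Finset.Ioc D₀ B).filter Nat.Prime := ⟨_, rfl⟩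
  obtain ⟨C, hC⟩ : ∃ C : ((Fin k × Fin k) × ℕ) → (Fin k → ℕ) → Prop,
      C = fun q t => q.2 ∣ t q.1.1 ∧ q.2 ∣ t q.1.2 := ⟨_, rfl⟩
  -- step 1: every bad tuple has a reason
  have step1 : ∑ t ∈ (Fintype.piFinset fun _ : Fin k => G1 W B).filter (fun t => ¬IsGood W t),
        ∏ l, 1 / ((t l).totient : ℝ) ≤
      ∑ t ∈ (Fintype.piFinset fun _ : Fin k => G1 W B).filter (fun t => ∃ q ∈ Q, C q t),
        ∏ l, 1 / ((t l).totient : ℝ) := by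
    refine Finset.sum_le_sum_of_subset_of_nonneg (fun t ht => ?_)
      fun t ht _ => hw0 t (Finset.mem_filter.1 ht).1
    rw [Finset.mem_filter] at ht ⊢
    refine ⟨ht.1, ?_⟩
    have hmem : ∀ i, t i ∈ G1 W B := fun i => Fintype.mem_piFinset.1 ht.1 i
    obtain ⟨ij, hij, p, hp, h1, h2⟩ := exists_prime_dvd_two_of_not_isGood hD hmem ht.2
    refine ⟨(ij, p), ?_, ?_⟩
    · rw [hQ, Finset.mem_product]; exact ⟨hij, hp⟩
    · rw [hC]; exact ⟨h1, h2⟩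
  -- step 2: union bound
  have step2 : ∑ t ∈ (Fintype.piFinset fun _ : Fin k => G1 W B).filter (fun t => ∃ q ∈ Q, C q t),
        ∏ l, 1 / ((t l).totient : ℝ) ≤
      ∑ q ∈ Q, ∑ t ∈ (Fintype.piFinset fun _ : Fin k => G1 W B).filter (C q),
        ∏ l, 1 / ((t l).totient : ℝ) :=
    sum_filter_exists_le Q _ C _ hw0
  -- step 3: each reason costs `L^k/(p-1)²`
  have step3 : ∀ q ∈ Q, ∑ t ∈ (Fintype.piFinset fun _ : Fin k => G1 W B).filter (C q),
        ∏ l, 1 / ((t l).totient : ℝ) ≤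
      (∑ n ∈ G1 W B, 1 / (n.totient : ℝ)) ^ k / ((q.2 : ℝ) - 1) ^ 2 := by
    intro q hq
    rw [hQ, Finset.mem_product, Finset.mem_offDiag, Finset.mem_filter] at hq
    have h := sum_prod_inv_totient_filter_dvd_le (W := W) hq.2.2 hB hq.1.2.2
    subst hC
    convert h using 4
  -- step 4: sum over the reasons
  have step4 : ∑ q ∈ Q, (∑ n ∈ G1 W B, 1 / (n.totient : ℝ)) ^ k / ((q.2 : ℝ) - 1) ^ 2 ≤
      (k : ℝ) ^ 2 * (∑ n ∈ G1 W B, 1 / (n.totient : ℝ)) ^ k / ((D₀ : ℝ) - 1) := by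
    rw [hQ, Finset.sum_product]
    have hinner : ∀ ij ∈ (Finset.univ : Finset (Fin k)).offDiag,
        ∑ p ∈ (Finset.Ioc D₀ B).filter Nat.Prime,
          (∑ n ∈ G1 W B, 1 / (n.totient : ℝ)) ^ k / ((((ij, p) : (Fin k × Fin k) × ℕ).2 : ℝ) - 1) ^ 2 ≤
        (∑ n ∈ G1 W B, 1 / (n.totient : ℝ)) ^ k * (1 / ((D₀ : ℝ) - 1)) := by
      intro ij _
      have hPs := SquarefreeSums.sum_primes_inv_sub_sq_le 1 D₀ B (by omega)
      simp only [Nat.cast_one] at hPs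
      calc _ = (∑ n ∈ G1 W B, 1 / (n.totient : ℝ)) ^ k *
            ∑ p ∈ (Finset.Ioc D₀ B).filter Nat.Prime, 1 / ((p : ℝ) - 1) ^ 2 := by
            rw [Finset.mul_sum]
            refine Finset.sum_congr rfl fun p _ => ?_
            ring
        _ ≤ _ := mul_le_mul_of_nonneg_left hPs (by positivity)
    calc _ ≤ ∑ ij ∈ (Finset.univ : Finset (Fin k)).offDiag,
          (∑ n ∈ G1 W B, 1 / (n.totient : ℝ)) ^ k * (1 / ((D₀ : ℝ) - 1)) := Finset.sum_le_sum hinner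
      _ = ((Finset.univ : Finset (Fin k)).offDiag.card : ℝ) *
          ((∑ n ∈ G1 W B, 1 / (n.totient : ℝ)) ^ k * (1 / ((D₀ : ℝ) - 1))) := by
          rw [Finset.sum_const, nsmul_eq_mul]
      _ ≤ (k : ℝ) ^ 2 * ((∑ n ∈ G1 W B, 1 / (n.totient : ℝ)) ^ k * (1 / ((D₀ : ℝ) - 1))) := by
          have hcard : ((Finset.univ : Finset (Fin k)).offDiag.card : ℝ) ≤ (k : ℝ) ^ 2 := by
            rw [Finset.offDiag_card, Finset.card_univ, Fintype.card_fin]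
            have : k * k - k ≤ k * k := Nat.sub_le _ _
            calc ((k * k - k : ℕ) : ℝ) ≤ ((k * k : ℕ) : ℝ) := by exact_mod_cast this
              _ = (k : ℝ) ^ 2 := by push_cast; ring
          have hD1 : (0 : ℝ) ≤ 1 / ((D₀ : ℝ) - 1) := by
            have : (2 : ℝ) ≤ D₀ := by exact_mod_cast hD2
            exact div_nonneg zero_le_one (by linarith)
          exact mul_le_mul_of_nonneg_right hcard (by positivity)
      _ = _ := by ring
  exact step1.trans (step2.trans ((Finset.sum_le_sum step3).trans step4))


/-! ### The diagonal sum and the weighted sum of the equidistribution lemma -/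

/-- `∏ᵢ (if pᵢ then aᵢ else 0) = (if ∀ i, pᵢ then ∏ aᵢ else 0)`. [folklore] -/
theorem prod_ite_zero_univ {p : Fin k → Prop} [DecidablePred p] (a : Fin k → ℝ) :
    ∏ i, (if p i then a i else 0) = if ∀ i, p i then ∏ i, a i else 0 := by
  by_cases h : ∀ i, p i
  · rw [if_pos h]
    exact Finset.prod_congr rfl fun i _ => if_pos (h i)
  · rw [if_neg h]
    obtain ⟨i, hi⟩ := not_forall.1 h
    exact Finset.prod_eq_zero (Finset.mem_univ i) (if_neg hi)

/-- **`y_r²` for Maynard's choice of `y`** (`maynardY_eq`): on the box, `y_r² = 1[r good] F(x_r)²`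
with `x_r = (log rᵢ/log R)ᵢ` (`μ(∏ rᵢ)⁴ = μ(∏ rᵢ)²`; coordinatewise coprimality to `W` and
`μ(∏ rᵢ) ≠ 0` together say that `r` is good). [cite: MaynardAnnals2015, §6, choice of y (p. 13)] -/
theorem maynardY_sq_eq (G : (Fin k → ℝ) → ℝ) (R : ℝ) (W : ℕ) {r : Fin k → ℕ}
    (hr : r ∈ maynardBox k R) :
    maynardY k ((maynardSimplex k).indicator G) R W r ^ 2 =
      if IsGood W r then (maynardSimplex k).indicator G (MaynardTao.logPos R r) ^ 2 else 0 := by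
  rw [maynardY_eq _ R W hr]
  have hlog : (fun i => Real.log (r i) / Real.log R) = MaynardTao.logPos R r := rfl
  rw [hlog]
  by_cases hg : IsGood W r
  · rw [if_pos hg, if_pos (fun i => hg.coprime_apply i)]
    have h1 : |((μ (∏ i, r i) : ℤ) : ℝ)| = 1 := by
      rw [← Int.cast_abs, ArithmeticFunction.abs_moebius_eq_one_of_squarefree hg.squarefree]
      simp
    have h2 : ((μ (∏ i, r i) : ℤ) : ℝ) ^ 2 = 1 := by rw [← sq_abs, h1, one_pow]
    rw [h2, one_mul, Set.indicator_indicator, Set.inter_self]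
  · rw [if_neg hg]
    by_cases hcop : ∀ i, Nat.Coprime (r i) W
    · rw [if_pos hcop]
      have hnsq : ¬Squarefree (∏ i, r i) := fun h =>
        hg ⟨h, Nat.Coprime.prod_left fun i _ => hcop i⟩
      rw [ArithmeticFunction.moebius_eq_zero_of_not_squarefree hnsq]
      simp
    · rw [if_neg hcop]; simp

/-- The diagonal sum `∑_r y_r²/∏ φ(rᵢ)` is the sum of `F(x_r)²/∏ φ(rᵢ)` over the good tuples of the
box (Maynard 2015, (6.4): "substitute our choice (6.3) of `y` into our expression"). [cite: MaynardAnnals2015, proof of Lemma 6.2, (6.4)] -/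
theorem sum_maynardY_sq_div_eq (G : (Fin k → ℝ) → ℝ) (R : ℝ) (W : ℕ) :
    ∑ r ∈ maynardBox k R, maynardY k ((maynardSimplex k).indicator G) R W r ^ 2 /
        ∏ i, (Nat.totient (r i) : ℝ) =
      ∑ r ∈ (maynardBox k R).filter (IsGood W),
        (maynardSimplex k).indicator G (MaynardTao.logPos R r) ^ 2 / ∏ i, (Nat.totient (r i) : ℝ) := by
  rw [Finset.sum_filter]
  refine Finset.sum_congr rfl fun r hr => ?_
  rw [maynardY_sq_eq G R W hr]
  split_ifs
  · rfl
  · rw [zero_div]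

/-- The weighted sum of `MaynardEquidistribution` for the weight `μ² 1_W/φ` in every coordinate is the
sum of `H(x_r)/∏ φ(rᵢ)` over the *coordinatewise* good tuples (each `rᵢ` squarefree and coprime to
`W`; no condition `(rᵢ, rⱼ) = 1`) — the left side of (6.5). [cite: MaynardAnnals2015, proof of Lemma 6.2, (6.5)] -/
theorem weightedSum_wfun_eq (W : ℕ) (R : ℝ) (H : (Fin k → ℝ) → ℝ) :
    MaynardTao.weightedSum (fun (_ : Fin k) (n : ℕ) => SquarefreeSums.wfun W SquarefreeSums.cTot n / n) R H =
      ∑ r ∈ (maynardBox k R).filter (fun r => ∀ i, Squarefree (r i) ∧ (r i).Coprime W),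
        H (MaynardTao.logPos R r) / ∏ i, (Nat.totient (r i) : ℝ) := by
  classical
  rw [MaynardTao.weightedSum, Finset.sum_filter]
  refine Finset.sum_congr rfl fun r hr => ?_
  have hr0 : ∀ i, r i ≠ 0 := fun i => by have := (mem_maynardBox_iff.1 hr i).1; omega
  rw [Finset.prod_congr rfl fun i _ => wfun_cTot_div_eq_ite (W := W) (hr0 i), prod_ite_zero_univ]
  split_ifs with h
  · rw [Finset.prod_div_distrib, Finset.prod_const_one, one_div_mul_eq_div]
  · rw [zero_mul]

/-- The coordinatewise good tuples of the box `[1, ⌊R⌋]^k` are the tuples of `G1 W ⌊R⌋`. [folklore] -/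
theorem filter_maynardBox_coord_eq (W : ℕ) (R : ℝ) :
    (maynardBox k R).filter (fun r => ∀ i, Squarefree (r i) ∧ (r i).Coprime W) =
      Fintype.piFinset fun _ : Fin k => G1 W ⌊R⌋₊ := by
  ext r
  simp only [Finset.mem_filter, mem_maynardBox_iff, Fintype.mem_piFinset, mem_G1]
  constructor
  · rintro ⟨h1, h2⟩ i; exact ⟨h1 i, h2 i⟩
  · intro h; exact ⟨fun i => (h i).1, fun i => (h i).2⟩

/-- The good tuples of the box are the good tuples among the coordinatewise good ones. [folklore] -/
theorem filter_maynardBox_isGood_eq (W : ℕ) (R : ℝ) :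
    (maynardBox k R).filter (IsGood W) =
      (Fintype.piFinset fun _ : Fin k => G1 W ⌊R⌋₊).filter (IsGood W) := by
  rw [← filter_maynardBox_coord_eq W R, Finset.filter_filter]
  refine Finset.filter_congr fun r _ => ?_
  exact ⟨fun h => ⟨fun i => ⟨h.squarefree_apply i, h.coprime_apply i⟩, h⟩, fun h => h.2⟩

/-- **Display (6.5)**: the weighted sum minus the diagonal sum is the sum over the bad tuples
(coordinatewise good, not good). [cite: MaynardAnnals2015, proof of Lemma 6.2, (6.5)] -/
theorem weightedSum_wfun_sub_eq (W : ℕ) (R : ℝ) (H : (Fin k → ℝ) → ℝ) :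
    MaynardTao.weightedSum (fun (_ : Fin k) (n : ℕ) => SquarefreeSums.wfun W SquarefreeSums.cTot n / n) R H -
        ∑ r ∈ (maynardBox k R).filter (IsGood W),
          H (MaynardTao.logPos R r) / ∏ i, (Nat.totient (r i) : ℝ) =
      ∑ r ∈ (Fintype.piFinset fun _ : Fin k => G1 W ⌊R⌋₊).filter (fun r => ¬IsGood W r),
        H (MaynardTao.logPos R r) / ∏ i, (Nat.totient (r i) : ℝ) := by
  classical
  rw [weightedSum_wfun_eq, filter_maynardBox_coord_eq, filter_maynardBox_isGood_eq,
    ← Finset.sum_filter_add_sum_filter_not (Fintype.piFinset fun _ : Fin k => G1 W ⌊R⌋₊) (IsGood W)]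
  ring

/-- The sum over the bad tuples is small: `|∑_bad H(x_r)/∏ φ(rᵢ)| ≤ H_max k² L^k/(D₀ − 1)`.
[cite: MaynardAnnals2015, proof of Lemma 6.2, (6.5)] -/
theorem abs_sum_bad_le {W D₀ : ℕ} {R : ℝ} (hB : 1 ≤ ⌊R⌋₊) (hD2 : 2 ≤ D₀)
    (hD : ∀ p, p.Prime → p ≤ D₀ → p ∣ W) {H : (Fin k → ℝ) → ℝ} {Hmax : ℝ}
    (hH : ∀ t, |H t| ≤ Hmax) :
    |∑ r ∈ (Fintype.piFinset fun _ : Fin k => G1 W ⌊R⌋₊).filter (fun r => ¬IsGood W r),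
        H (MaynardTao.logPos R r) / ∏ i, (Nat.totient (r i) : ℝ)| ≤
      Hmax * ((k : ℝ) ^ 2 * (∑ n ∈ G1 W ⌊R⌋₊, 1 / (n.totient : ℝ)) ^ k / ((D₀ : ℝ) - 1)) := by
  classical
  have hH0 : 0 ≤ Hmax := (abs_nonneg _).trans (hH 0)
  refine (Finset.abs_sum_le_sum_abs _ _).trans ?_
  calc ∑ r ∈ (Fintype.piFinset fun _ : Fin k => G1 W ⌊R⌋₊).filter (fun r => ¬IsGood W r),
        |H (MaynardTao.logPos R r) / ∏ i, (Nat.totient (r i) : ℝ)|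
      ≤ ∑ r ∈ (Fintype.piFinset fun _ : Fin k => G1 W ⌊R⌋₊).filter (fun r => ¬IsGood W r),
        Hmax * ∏ l, 1 / ((r l).totient : ℝ) := by
        refine Finset.sum_le_sum fun r hr => ?_
        have hP : 0 < ∏ i, (Nat.totient (r i) : ℝ) := Finset.prod_pos fun i _ => by
          have hr1 := (mem_G1.1 (Fintype.mem_piFinset.1 (Finset.mem_filter.1 hr).1 i)).1.1
          exact_mod_cast Nat.totient_pos.2 hr1
        have hprod : (∏ l, 1 / ((r l).totient : ℝ)) * ∏ i, (Nat.totient (r i) : ℝ) = 1 := by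
          rw [Finset.prod_div_distrib, Finset.prod_const_one, one_div_mul_cancel hP.ne']
        rw [abs_div, abs_of_pos hP, div_le_iff₀ hP, mul_assoc, hprod, mul_one]
        exact hH _
    _ = Hmax * ∑ r ∈ (Fintype.piFinset fun _ : Fin k => G1 W ⌊R⌋₊).filter (fun r => ¬IsGood W r),
        ∏ l, 1 / ((r l).totient : ℝ) := by rw [Finset.mul_sum]
    _ ≤ _ := mul_le_mul_of_nonneg_left (sum_prod_inv_totient_not_isGood_le hB hD2 hD) hH0

/-! ### The integral and the scale -/

/-- `F² = 1_{R_k} G²` for `F = 1_{R_k} G`, with `R_k` written as the polytope of the equidistribution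
lemma. [folklore] -/
theorem indicator_sq_eq (G : (Fin k → ℝ) → ℝ) (t : Fin k → ℝ) :
    (maynardSimplex k).indicator G t ^ 2 =
      (MaynardTao.polytope (fun _ : Unit => (Finset.univ : Finset (Fin k)))).indicator
        (fun t => G t ^ 2) t := by
  rw [MaynardTao.polytope_univ_eq_maynardSimplex]
  by_cases ht : t ∈ maynardSimplex k
  · rw [Set.indicator_of_mem ht, Set.indicator_of_mem ht]
  · rw [Set.indicator_of_notMem ht, Set.indicator_of_notMem ht, zero_pow two_ne_zero]

/-- `∫_{[0,1]^k} 1_{R_k} G² = I_k(1_{R_k} G)`. [cite: MaynardAnnals2015, proof of Lemma 6.2, (6.7)] -/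
theorem integral_cube_indicator_sq_eq (G : (Fin k → ℝ) → ℝ) :
    ∫ t in maynardCube k, (MaynardTao.polytope (fun _ : Unit => (Finset.univ : Finset (Fin k)))).indicator
        (fun t => G t ^ 2) t =
      maynardI k ((maynardSimplex k).indicator G) := by
  rw [MaynardTao.polytope_univ_eq_maynardSimplex, setIntegral_indicator (measurableSet_maynardSimplex k),
    Set.inter_eq_right.2 (maynardSimplex_subset_maynardCube k), maynardI]
  refine setIntegral_congr_fun (measurableSet_maynardSimplex k) fun t ht => ?_
  simp only [Set.indicator_of_mem ht]

/-- `maynardSumScale = ((φ(W)/W) log R)^k`. [folklore] -/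
theorem maynardSumScale_eq_pow (k : ℕ) (θ δ : ℝ) (N : ℕ) :
    maynardSumScale k θ δ N =
      ((Nat.totient (maynardW N) : ℝ) / (maynardW N) * Real.log (maynardR θ δ N)) ^ k := by
  rw [maynardSumScale, mul_pow, div_pow]
  ring


/-! ### Real-variable bookkeeping for the assembly -/

/-- The error bracket of the equidistribution lemma is small: with `ω = ε/16`, `2 H L'/M ≤ ε/32`,
`0 ≤ η ≤ 1` and `H k 2^{k−1} η ≤ ε/8` (`ε ≤ 1`),
`((1+η)^k + 1)(ω + 2 H L'/M) + H((1+η)^k − 1) ≤ ε/2`. [folklore] -/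
theorem bracket_le {k : ℕ} {ε η ω H q : ℝ} (hH : 0 ≤ H)
    (hη0 : 0 ≤ η) (hω : ω = ε / 16) (hq0 : 0 ≤ q) (hq : q ≤ ε / 32)
    (hηk : H * (k * η * 2 ^ (k - 1)) ≤ ε / 8) (hηk' : k * η * 2 ^ (k - 1) ≤ 1 / 8) (hη1 : η ≤ 1) :
    ((1 + η) ^ k + 1) * (ω + q) + H * ((1 + η) ^ k - 1) ≤ ε / 2 := by
  have hZ1 : (1 : ℝ) ≤ 1 + η := by linarith
  have hpow : (1 + η) ^ k - 1 ≤ k * η * 2 ^ (k - 1) := by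
    calc (1 + η) ^ k - 1 ≤ k * ((1 + η) - 1) * (1 + η) ^ (k - 1) := SquarefreeSums.pow_sub_one_le hZ1 k
      _ = k * η * (1 + η) ^ (k - 1) := by ring
      _ ≤ k * η * 2 ^ (k - 1) := by
          gcongr
          · linarith
  have hP3 : (1 + η) ^ k + 1 ≤ 3 := by linarith
  have hε0 : 0 ≤ ε := by linarith [hq0.trans hq]
  calc ((1 + η) ^ k + 1) * (ω + q) + H * ((1 + η) ^ k - 1)
      ≤ 3 * (ε / 16 + ε / 32) + H * (k * η * 2 ^ (k - 1)) := by
        gcongr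
        · linarith [hq0]
        · rw [hω]
    _ ≤ 3 * (ε / 16 + ε / 32) + ε / 8 := by linarith
    _ ≤ ε / 2 := by linarith

end MaynardSieve

set_option maxHeartbeats 400000 in
open MaynardSieve MaynardTao in
/-- **Maynard 2015, proof of Lemma 6.2, (6.4)–(6.7)** — the named fact `Literature.NumberTheory.Sieve.maynard_lemma62_sum` of
`MaynardSieveS1.lean`, PROVED: for `y_r = μ(∏ rᵢ)² 1[(rᵢ,W)=1] F(log rᵢ/log R)` (`F = 1_{R_k} G`,
`G ∈ C¹`; only continuity is used), `∑_r y_r²/∏ φ(rᵢ) = (φ(W)/W)^k (log R)^k (I_k(F) + o(1))`.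
Proof: (6.4) `maynardY_sq_eq`; (6.5) the tuples with a common prime `p > D₀` in two coordinates cost
`≪ k² L^k/D₀` (`abs_sum_bad_le`, `L = ∑_{u ≤ R,(u,W)=1} μ²/φ(u) ≪ (φ(W)/W) log R` by
`SquarefreeSums.abs_sum_inv_totient_sub_le`); (6.6)–(6.7) the tree's `k`-dimensional Riemann-sum
replacement `MaynardTao.abs_weightedSum_sub_integral_le` for the `k` applications of Lemma 6.1, fed
with the counting function of `μ² 1_W/φ` (`abs_massUpTo_wfun_sub_le`), the uniform continuity of
`G²` on `[0,1]^k`, and `D₀ = ⌊log log log N⌋ → ∞` (so that `B(2) D₀^{-1/4} → 0` and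
`(harmErr W + 4)/((φ(W)/W) log R) → 0`). [cite: MaynardAnnals2015, proof of Lemma 6.2, (6.4)–(6.7)] -/
theorem maynard_lemma62_sum_holds : maynard_lemma62_sum := by
  intro k hk θ δ hδ hη G hG
  classical
  have hGc : Continuous G := hG.continuous
  have hcubeK : IsCompact (maynardCube k) := isCompact_univ_pi fun _ => isCompact_Icc
  -- `|G| ≤ Gmax` on the cube, `g = G²`
  obtain ⟨Gmax, hG0, hGmax⟩ : ∃ M : ℝ, 0 ≤ M ∧ ∀ x ∈ maynardCube k, |G x| ≤ M := by
    obtain ⟨M, hM⟩ := hcubeK.exists_bound_of_continuousOn hGc.continuousOn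
    exact ⟨max M 0, le_max_right _ _, fun x hx =>
      (Real.norm_eq_abs (G x) ▸ hM x hx).trans (le_max_left _ _)⟩
  obtain ⟨g, hg⟩ : ∃ g : (Fin k → ℝ) → ℝ, g = fun t => G t ^ 2 := ⟨_, rfl⟩
  have hgc : Continuous g := by rw [hg]; exact hGc.pow 2
  have hgb : ∀ t ∈ maynardCube k, |g t| ≤ Gmax ^ 2 := fun t ht => by
    rw [hg]; dsimp only; rw [abs_pow]; exact pow_le_pow_left₀ (abs_nonneg _) (hGmax t ht) 2
  have hH2 : 0 ≤ Gmax ^ 2 := by positivity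
  -- the polytope data
  obtain ⟨S, hS⟩ : ∃ S : Unit → Finset (Fin k), S = fun _ => Finset.univ := ⟨_, rfl⟩
  have hPoly : polytope S = maynardSimplex k := by rw [hS]; exact polytope_univ_eq_maynardSimplex k
  obtain ⟨H, hHdef⟩ : ∃ H : (Fin k → ℝ) → ℝ, H = (polytope S).indicator g := ⟨_, rfl⟩
  have hHF : ∀ t, (maynardSimplex k).indicator G t ^ 2 = H t := fun t => by
    rw [hHdef, hg, hS]; exact indicator_sq_eq G t
  have hHb : ∀ t, |H t| ≤ Gmax ^ 2 := fun t => by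
    rw [hHdef, hPoly]
    by_cases ht : t ∈ maynardSimplex k
    · rw [Set.indicator_of_mem ht]; exact hgb t (maynardSimplex_subset_maynardCube k ht)
    · rw [Set.indicator_of_notMem ht, abs_zero]; positivity
  have hint : IntegrableOn ((polytope S).indicator g) (maynardCube k) volume := by
    refine (hgc.continuousOn.integrableOn_compact hcubeK).indicator ?_
    rw [hPoly]; exact measurableSet_maynardSimplex k
  have hIint : ∫ t in maynardCube k, (polytope S).indicator g t = maynardI k ((maynardSimplex k).indicator G) := by
    rw [hS, hg]; exact integral_cube_indicator_sq_eq G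
  have hL' : ∑ l, ((S l).card + 1 : ℝ) = k + 1 := by
    rw [hS]; simp
  -- uniform continuity of `g`
  have huc : UniformContinuousOn g (maynardCube k) := hcubeK.uniformContinuousOn_of_continuous hgc.continuousOn
  -- the target
  rw [Asymptotics.isLittleO_iff]
  intro ε₀ hε₀
  obtain ⟨ε₁, hε₁⟩ : ∃ e : ℝ, e = min ε₀ 1 := ⟨_, rfl⟩
  have hε₁0 : 0 < ε₁ := by rw [hε₁]; exact lt_min hε₀ one_pos
  have hε₁1 : ε₁ ≤ 1 := by rw [hε₁]; exact min_le_right _ _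
  have hε₁ε : ε₁ ≤ ε₀ := by rw [hε₁]; exact min_le_left _ _
  -- `ω = ε₁/16` and the mesh `M`
  obtain ⟨δ₁, hδ₁, hδ⟩ := Metric.uniformContinuousOn_iff.1 huc (ε₁ / 16) (by positivity)
  obtain ⟨M, hM1, hM2⟩ : ∃ M : ℕ, 1 / δ₁ < M ∧ 64 * Gmax ^ 2 * (k + 1) / ε₁ ≤ M := by
    refine ⟨⌈max (1 / δ₁) (64 * Gmax ^ 2 * (k + 1) / ε₁)⌉₊ + 1, ?_, ?_⟩
    · calc 1 / δ₁ ≤ max (1 / δ₁) (64 * Gmax ^ 2 * (k + 1) / ε₁) := le_max_left _ _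
        _ ≤ ⌈max (1 / δ₁) (64 * Gmax ^ 2 * (k + 1) / ε₁)⌉₊ := Nat.le_ceil _
        _ < _ := by push_cast; linarith
    · calc 64 * Gmax ^ 2 * (k + 1) / ε₁ ≤ max (1 / δ₁) (64 * Gmax ^ 2 * (k + 1) / ε₁) := le_max_right _ _
        _ ≤ ⌈max (1 / δ₁) (64 * Gmax ^ 2 * (k + 1) / ε₁)⌉₊ := Nat.le_ceil _
        _ ≤ _ := by push_cast; linarith
  have hM0 : (0 : ℝ) < M := lt_of_le_of_lt (by positivity) hM1
  have hMpos : 0 < M := by exact_mod_cast hM0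
  have hcont : ∀ t ∈ maynardCube k, ∀ t' ∈ maynardCube k,
      (∀ i, |t i - t' i| ≤ 1 / (M : ℝ)) → |g t - g t'| ≤ ε₁ / 16 := by
    intro t ht t' ht' hd
    have h1 : dist t t' ≤ 1 / (M : ℝ) :=
      (dist_pi_le_iff (by positivity)).2 fun i => by rw [Real.dist_eq]; exact hd i
    have h2 : 1 / (M : ℝ) < δ₁ := by
      rw [div_lt_iff₀ hM0]
      calc (1 : ℝ) = δ₁ * (1 / δ₁) := by field_simp
        _ < δ₁ * M := by gcongr
    have := hδ t ht t' ht' (by linarith)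
    rw [Real.dist_eq] at this
    exact this.le
  have hq : 2 * Gmax ^ 2 * (k + 1 : ℝ) / M ≤ ε₁ / 32 := by
    rw [div_le_iff₀ hM0]
    have := (div_le_iff₀ hε₁0).1 hM2
    linarith
  -- `η₀`
  obtain ⟨A, hA⟩ : ∃ A : ℝ, A = Gmax ^ 2 * k * 2 ^ (k - 1) + k * 2 ^ (k - 1) + 1 := ⟨_, rfl⟩
  have hA0 : 0 < A := by rw [hA]; positivity
  obtain ⟨η₀, hη₀⟩ : ∃ e : ℝ, e = min 1 (ε₁ / (8 * A)) := ⟨_, rfl⟩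
  have hη₀0 : 0 < η₀ := by rw [hη₀]; exact lt_min one_pos (by positivity)
  have hη₀1 : η₀ ≤ 1 := by rw [hη₀]; exact min_le_left _ _
  have hη₀A : A * η₀ ≤ ε₁ / 8 := by
    have : η₀ ≤ ε₁ / (8 * A) := by rw [hη₀]; exact min_le_right _ _
    rw [le_div_iff₀ (by positivity)] at this
    linarith
  -- constants for `L` and the bad tuples
  obtain ⟨b, hb⟩ : ∃ b : ℝ, b = SquarefreeSums.bConst 2 := ⟨_, rfl⟩
  have hb0 : 0 < b := by rw [hb]; unfold SquarefreeSums.bConst; positivity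
  obtain ⟨CL, hCL⟩ : ∃ C : ℝ, C = 2 + b := ⟨_, rfl⟩
  have hCL0 : 0 ≤ CL := by rw [hCL]; positivity
  obtain ⟨Dbad, hDbad⟩ : ∃ D : ℕ, D = ⌈4 * Gmax ^ 2 * (k : ℝ) ^ 2 * CL ^ k / ε₁⌉₊ + 1 := ⟨_, rfl⟩
  -- `ε(N) = b D₀^{-1/4} → 0`
  have hεD : ∀ᶠ N : ℕ in atTop, b * (maynardD0 N : ℝ) ^ (-(1 : ℝ) / 4) ≤ η₀ / (4 * M) := by
    have h1 : Tendsto (fun N : ℕ => b * (maynardD0 N : ℝ) ^ (-(1 / 4 : ℝ))) atTop (nhds (b * 0)) :=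
      ((tendsto_rpow_neg_atTop (by norm_num : (0 : ℝ) < 1 / 4)).comp tendsto_maynardD0_atTop).const_mul b
    rw [mul_zero] at h1
    have h2 := h1.eventually (eventually_le_nhds (show (0 : ℝ) < η₀ / (4 * M) by positivity))
    filter_upwards [h2] with N hN
    have : (-(1 : ℝ) / 4) = -(1 / 4 : ℝ) := by norm_num
    rw [this]; exact hN
  filter_upwards [eventually_one_le_loglog, tendsto_maynardD0_atTop'.eventually_ge_atTop (max 3 Dbad),
    eventually_two_le_maynardR hη,
    eventually_mul_loglog_pow_le_log (13 * b + 1) 3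
      (show (0 : ℝ) < (θ / 2 - δ) * (η₀ / (4 * M)) by positivity),
    hεD, eventually_ge_atTop 1] with N hll hD0 hR2 hE3 hεN hN1
  -- basic facts on `D₀, W, R, B = ⌊R⌋`
  have hD3 : 3 ≤ maynardD0 N := le_of_max_le_left hD0
  have hDbadle : Dbad ≤ maynardD0 N := le_of_max_le_right hD0
  have hD1 : 1 ≤ maynardD0 N := by omega
  have hDr : (3 : ℝ) ≤ maynardD0 N := by exact_mod_cast hD3
  have hDpos : (0 : ℝ) < maynardD0 N := by linarith
  have hW0 : maynardW N ≠ 0 := primorial_ne_zero _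
  have hWpos : (0 : ℝ) < maynardW N := by exact_mod_cast primorial_pos _
  have hDW : ∀ p, p.Prime → p ≤ maynardD0 N → p ∣ maynardW N := fun p hp hpD =>
    (Nat.Prime.dvd_primorial_iff hp).2 hpD
  have hR1 : 1 < maynardR θ δ N := by linarith
  have hRpos : 0 < maynardR θ δ N := by linarith
  have hB1 : 1 ≤ ⌊maynardR θ δ N⌋₊ := Nat.le_floor (by simp only [Nat.cast_one]; linarith)
  have hBR : (⌊maynardR θ δ N⌋₊ : ℝ) ≤ maynardR θ δ N := Nat.floor_le hRpos.le
  have hB1r : (1 : ℝ) ≤ ⌊maynardR θ δ N⌋₊ := by exact_mod_cast hB1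
  have hNpos : (0 : ℝ) < N := by exact_mod_cast hN1
  have hlogR : Real.log (maynardR θ δ N) = (θ / 2 - δ) * Real.log N := by
    rw [maynardR, Real.log_rpow hNpos]
  have hlogR0 : 0 < Real.log (maynardR θ δ N) := Real.log_pos hR1
  have hlogB : Real.log ⌊maynardR θ δ N⌋₊ ≤ Real.log (maynardR θ δ N) :=
    Real.log_le_log (by linarith) hBR
  -- `φ_W = φ(W)/W`
  obtain ⟨φW, hφW⟩ : ∃ x : ℝ, x = (Nat.totient (maynardW N) : ℝ) / maynardW N := ⟨_, rfl⟩
  have hφWpos : 0 < φW := by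
    rw [hφW]; exact div_pos (by exact_mod_cast Nat.totient_pos.2 (primorial_pos _)) hWpos
  have hφW1 : φW ≤ 1 := by
    rw [hφW, div_le_one hWpos]; exact_mod_cast Nat.totient_le _
  have hφWD : 1 / (maynardD0 N : ℝ) ≤ φW := hφW ▸ one_div_le_totient_primorial_div hD1
  obtain ⟨P, hP⟩ : ∃ P : ℝ, P = φW * Real.log (maynardR θ δ N) := ⟨_, rfl⟩
  have hP0 : 0 < P := by rw [hP]; positivity
  have hScale : maynardSumScale k θ δ N = P ^ k := by rw [hP, hφW]; exact maynardSumScale_eq_pow k θ δ N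
  -- `E3`: `(harmErr W + 4) b + 1 ≤ (η₀/(4M)) φ_W log R` (and a fortiori `≤ φ_W log R`)
  obtain ⟨E, hE⟩ : ∃ E : ℝ, E = (SquarefreeSums.harmErr (maynardW N) + 4) * b + 1 := ⟨_, rfl⟩
  have hE0 : 0 ≤ E := by
    rw [hE]
    have : 0 ≤ SquarefreeSums.harmErr (maynardW N) := SquarefreeSums.harmErr_nonneg _
    positivity
  have hE3' : E ≤ η₀ / (4 * M) * P := by
    have h16 : (16 : ℝ) ^ maynardD0 N ≤ Real.log (Real.log N) ^ 3 :=
      (pow_maynardD0_le (c := 16) (by norm_num) hll).trans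
        (pow_le_pow_right₀ hll natCeil_log_sixteen_le)
    have hharm := harmErr_primorial_add_four_le hD1
    have hD2D : (maynardD0 N : ℝ) ≤ 2 ^ maynardD0 N := by exact_mod_cast (Nat.lt_two_pow_self).le
    have h18 : (1 : ℝ) ≤ 8 ^ maynardD0 N := one_le_pow₀ (by norm_num)
    have key : E * maynardD0 N ≤ η₀ / (4 * M) * Real.log (maynardR θ δ N) := by
      calc E * maynardD0 N ≤ ((13 * 8 ^ maynardD0 N) * b + 1 * 8 ^ maynardD0 N) * 2 ^ maynardD0 N := by
            rw [hE]; gcongr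
            · unfold maynardW; linarith
            · linarith
        _ = (13 * b + 1) * 16 ^ maynardD0 N := by
            rw [show (16 : ℝ) = 8 * 2 by norm_num, mul_pow]; ring
        _ ≤ (13 * b + 1) * Real.log (Real.log N) ^ 3 := by gcongr
        _ ≤ (θ / 2 - δ) * (η₀ / (4 * M)) * Real.log N := hE3
        _ = η₀ / (4 * M) * Real.log (maynardR θ δ N) := by rw [hlogR]; ring
    calc E = E * maynardD0 N * (1 / maynardD0 N) := by field_simp
      _ ≤ (η₀ / (4 * M) * Real.log (maynardR θ δ N)) * φW :=
          mul_le_mul key hφWD (by positivity) (by positivity)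
      _ = η₀ / (4 * M) * P := by rw [hP]; ring
  have hEP : E ≤ P := by
    refine hE3'.trans ?_
    have : η₀ / (4 * M) ≤ 1 := by
      rw [div_le_one (by positivity)]
      have : (1 : ℝ) ≤ M := by exact_mod_cast hMpos
      linarith
    exact (mul_le_of_le_one_left hP0.le this)
  -- `L ≤ CL · P`
  obtain ⟨L, hLdef⟩ : ∃ L : ℝ, L = ∑ n ∈ G1 (maynardW N) ⌊maynardR θ δ N⌋₊, 1 / (n.totient : ℝ) :=
    ⟨_, rfl⟩
  have hL0 : 0 ≤ L := by rw [hLdef]; exact Finset.sum_nonneg fun _ _ => by positivity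
  have hL : L ≤ CL * P := by
    have h := SquarefreeSums.abs_sum_inv_totient_sub_le hW0 hD1 hDW hB1
    rw [← G1, ← hLdef, ← hφW, ← hb] at h
    have h' := (abs_sub_le_iff.1 h).1
    have hD14 : (maynardD0 N : ℝ) ^ (-(1 : ℝ) / 4) ≤ 1 :=
      Real.rpow_le_one_of_one_le_of_nonpos (by linarith) (by norm_num)
    have hKP : (SquarefreeSums.harmErr (maynardW N) + 4) * b ≤ P := by linarith [hEP, hE]
    calc L ≤ φW * Real.log ⌊maynardR θ δ N⌋₊ +
          ((SquarefreeSums.harmErr (maynardW N) + 4) * b +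
            φW * (b * (maynardD0 N : ℝ) ^ (-(1 : ℝ) / 4)) * Real.log ⌊maynardR θ δ N⌋₊) := by linarith
      _ ≤ φW * Real.log (maynardR θ δ N) + (P + φW * (b * 1) * Real.log (maynardR θ δ N)) := by
          gcongr
      _ = CL * P := by rw [hCL, hP]; ring
  -- (6.5): the bad tuples
  have hbad := abs_sum_bad_le (k := k) (H := H) hB1 (by omega : 2 ≤ maynardD0 N) hDW hHb
    (R := maynardR θ δ N)
  rw [← hLdef] at hbad
  have hbad' : Gmax ^ 2 * ((k : ℝ) ^ 2 * L ^ k / ((maynardD0 N : ℝ) - 1)) ≤ ε₁ / 4 * P ^ k := by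
    have hDb : 4 * Gmax ^ 2 * (k : ℝ) ^ 2 * CL ^ k / ε₁ ≤ (maynardD0 N : ℝ) - 1 := by
      have h1 : (Dbad : ℝ) ≤ maynardD0 N := by exact_mod_cast hDbadle
      rw [hDbad] at h1
      push_cast at h1
      linarith [Nat.le_ceil (4 * Gmax ^ 2 * (k : ℝ) ^ 2 * CL ^ k / ε₁)]
    have hDm1 : (0 : ℝ) < (maynardD0 N : ℝ) - 1 := by linarith
    rw [mul_div_assoc', div_le_iff₀ hDm1]
    calc Gmax ^ 2 * ((k : ℝ) ^ 2 * L ^ k) ≤ Gmax ^ 2 * ((k : ℝ) ^ 2 * (CL * P) ^ k) := by gcongr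
      _ = (4 * Gmax ^ 2 * (k : ℝ) ^ 2 * CL ^ k / ε₁) * (ε₁ / 4 * P ^ k) := by
          rw [mul_pow]; field_simp
      _ ≤ ((maynardD0 N : ℝ) - 1) * (ε₁ / 4 * P ^ k) := by gcongr
      _ = ε₁ / 4 * P ^ k * ((maynardD0 N : ℝ) - 1) := by ring
  -- (6.6)–(6.7): the equidistribution lemma
  have hH : ∀ i : Fin k, ∀ y : ℝ, 1 ≤ y →
      |massUpTo ((fun (_ : Fin k) (n : ℕ) =>
          SquarefreeSums.wfun (maynardW N) SquarefreeSums.cTot n / n) i) ⌊y⌋₊ - φW * Real.log y| ≤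
        b * (maynardD0 N : ℝ) ^ (-(1 : ℝ) / 4) * φW * Real.log y + E := by
    intro i y hy
    rw [hφW, hE, hb]
    exact abs_massUpTo_wfun_sub_le hW0 hD1 hDW hy
  have hmain := abs_weightedSum_sub_integral_le hk S (fun _ u => wfun_cTot_div_nonneg (maynardW N) u)
    hφWpos (by positivity : 0 ≤ b * (maynardD0 N : ℝ) ^ (-(1 : ℝ) / 4)) hE0 hH hR1 hMpos
    (by positivity : (0 : ℝ) ≤ ε₁ / 16) hH2 hcont hgb hint
  rw [hIint, hL', ← hP, ← hHdef] at hmain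
  -- `η ≤ η₀`
  obtain ⟨η, hηdef⟩ : ∃ e : ℝ, e = 2 * M * (b * (maynardD0 N : ℝ) ^ (-(1 : ℝ) / 4) + E / P) := ⟨_, rfl⟩
  rw [← hηdef] at hmain
  have hη0 : 0 ≤ η := by rw [hηdef]; positivity
  have hηle : η ≤ η₀ := by
    have h2 : E / P ≤ η₀ / (4 * M) := by rw [div_le_iff₀ hP0]; exact hE3'
    calc η ≤ 2 * M * (η₀ / (4 * M) + η₀ / (4 * M)) := by rw [hηdef]; gcongr
      _ = η₀ := by field_simp; ring
  have hη1 : η ≤ 1 := hηle.trans hη₀1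
  have hηk' : (k : ℝ) * η * 2 ^ (k - 1) ≤ 1 / 8 := by
    have : (k : ℝ) * 2 ^ (k - 1) * η₀ ≤ A * η₀ := by
      refine mul_le_mul_of_nonneg_right ?_ hη₀0.le
      have hu : (0 : ℝ) ≤ Gmax ^ 2 * k * 2 ^ (k - 1) := by positivity
      rw [hA]; linarith
    calc (k : ℝ) * η * 2 ^ (k - 1) = (k : ℝ) * 2 ^ (k - 1) * η := by ring
      _ ≤ (k : ℝ) * 2 ^ (k - 1) * η₀ := by gcongr
      _ ≤ A * η₀ := this
      _ ≤ ε₁ / 8 := hη₀A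
      _ ≤ 1 / 8 := by linarith
  have hηk : Gmax ^ 2 * ((k : ℝ) * η * 2 ^ (k - 1)) ≤ ε₁ / 8 := by
    have : Gmax ^ 2 * (k : ℝ) * 2 ^ (k - 1) * η₀ ≤ A * η₀ := by
      refine mul_le_mul_of_nonneg_right ?_ hη₀0.le
      have hv : (0 : ℝ) ≤ k * 2 ^ (k - 1) := by positivity
      rw [hA]; linarith
    calc Gmax ^ 2 * ((k : ℝ) * η * 2 ^ (k - 1)) = Gmax ^ 2 * (k : ℝ) * 2 ^ (k - 1) * η := by ring
      _ ≤ Gmax ^ 2 * (k : ℝ) * 2 ^ (k - 1) * η₀ := by gcongr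
      _ ≤ A * η₀ := this
      _ ≤ ε₁ / 8 := hη₀A
  have hbr := bracket_le (k := k) (H := Gmax ^ 2) hH2 hη0 rfl (by positivity) hq hηk hηk' hη1
  -- assemble
  have hT : |weightedSum (fun (_ : Fin k) (n : ℕ) =>
      SquarefreeSums.wfun (maynardW N) SquarefreeSums.cTot n / n) (maynardR θ δ N) H -
      P ^ k * maynardI k ((maynardSimplex k).indicator G)| ≤ P ^ k * (ε₁ / 2) :=
    hmain.trans (mul_le_mul_of_nonneg_left hbr (by positivity))
  have hLHS : ∑ r ∈ maynardBox k (maynardR θ δ N),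
      maynardY k ((maynardSimplex k).indicator G) (maynardR θ δ N) (maynardW N) r ^ 2 /
        ∏ i, (Nat.totient (r i) : ℝ) =
      ∑ r ∈ (maynardBox k (maynardR θ δ N)).filter (IsGood (maynardW N)),
        H (logPos (maynardR θ δ N) r) / ∏ i, (Nat.totient (r i) : ℝ) := by
    rw [sum_maynardY_sq_div_eq]
    exact Finset.sum_congr rfl fun r _ => by rw [hHF]
  have hdiff := weightedSum_wfun_sub_eq (maynardW N) (maynardR θ δ N) H
  rw [Real.norm_eq_abs, Real.norm_eq_abs, hScale, abs_of_pos (pow_pos hP0 k), hLHS]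
  have hsplit : ∀ (x T s : ℝ), |x - s| ≤ |T - x| + |T - s| := fun x T s => by
    calc |x - s| = |(T - s) - (T - x)| := by ring_nf
      _ ≤ |T - s| + |T - x| := abs_sub _ _
      _ = _ := add_comm _ _
  refine (hsplit _ (weightedSum (fun (_ : Fin k) (n : ℕ) =>
    SquarefreeSums.wfun (maynardW N) SquarefreeSums.cTot n / n) (maynardR θ δ N) H) _).trans ?_
  rw [hdiff]
  have hfin : ε₁ / 4 * P ^ k + P ^ k * (ε₁ / 2) ≤ ε₀ * P ^ k := by
    have e : ε₁ / 4 * P ^ k + P ^ k * (ε₁ / 2) = (3 / 4 * ε₁) * P ^ k := by ring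
    rw [e]
    exact mul_le_mul_of_nonneg_right (by linarith) (pow_pos hP0 k).le
  exact (add_le_add hbad hT).trans ((add_le_add hbad' le_rfl).trans hfin)

/-- **Maynard 2015, Lemma 6.2 = the `S₁` half of Proposition 4.1** — the named fact
`Literature.NumberTheory.Sieve.maynard_S1_asymptotic` of `MaynardSieve.lean` DISCHARGED: Lemma 5.1 (`maynard_lemma51_holds`,
`MaynardSieveLemma51.lean`) and (6.4)–(6.7) (`maynard_lemma62_sum_holds`).
[cite: MaynardAnnals2015, Lemma 6.2] -/
theorem maynard_S1_asymptotic_holds : maynard_S1_asymptotic :=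
  maynard_S1_asymptotic_of_lemma62_sum maynard_lemma62_sum_holds

end Literature.NumberTheory.Sieve
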